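import Mathlib
import Summits.PneNP.PneNP.Theorems.OverlapGapAlgebraSolvableImpliesStableSectionMonotoneRepairTreeCount

/-!
# PneNP / OverlapGapAlgebra — crux `SolvableImpliesStableSection` (stmt-PneNP-2463):
# the TWO-WAY REPAIR block (1/·) — exact count of an injective witness tree

Support for crux `stmt-PneNP-2463` (`Summit.PneNP.PneNP.Theses.OverlapGapAlgebra.SolvableImpliesStableSection`):
the f-free block "bounded-round TWO-WAY repair with one-round memory gives stable sections for every
`ν > 0` up to `α ≤ 2^k/(4k)`" (no dead floor), which supersedes the monotone-repair block.
Witness trees are the tree codes of `…MonotoneRepairTreeAsm` (finite sets of labelled addresses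
`(a, (x, c))`), the label now carrying the CODE `c = 2·round + τ` of the node, `τ = 1` iff the flipped
(least childless) slot of the node is positive (a `false → true` flip).  SYNTACTIC VALIDITY in an
instance `Φ`: at every node and slot, the sign is positive iff a child OF EVEN CODE hangs there or the
slot is childless and the node's own code is odd; and the variable of a child-bearing slot equals the
variable of the least childless slot of the child's clause.  The sign family is again functional on the
node slots and the variable equations again form a star system, whence (via `sissR_starCount`)

* `sissW_treeCount` — `#{Φ : T syntactically valid in Φ} · 2^{k|T|} · n^{|T|-1} = #Inst`

for every well-formed injective code `T`.  No definitions; axioms `propext`, `Classical.choice`,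
`Quot.sound`.
-/

set_option linter.dupNamespace false -- `Summit.PneNP.PneNP.…`: summit = sub-problem (D-0017)

namespace Summit.PneNP.PneNP.Theorems

open Finset
open scoped Classical

section TreeCount

variable {m k n : ℕ}

/-- **Exact count of an injective two-way witness tree.** Let the tree code `T` be well formed — at
most one label per address, closed under passing to the parent address, exactly one root, every child
with a childless slot — and INJECTIVE (distinct nodes carry distinct clauses). Then the instances in
which `T` is syntactically valid (two-way sign rule) number exactly `#Inst / (2^{k|T|} n^{|T|-1})`. -/
theorem sissW_treeCount (T : Finset (List (Fin k) × (Fin m × ℕ)))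
    (hfun : ∀ (a : List (Fin k)) (lab lab' : Fin m × ℕ), (a, lab) ∈ T → (a, lab') ∈ T → lab = lab')
    (hpar : ∀ (j : Fin k) (a : List (Fin k)) (lab : Fin m × ℕ), (j :: a, lab) ∈ T →
      ∃ lab' : Fin m × ℕ, (a, lab') ∈ T)
    (hrootc : (T.filter fun e => e.1 = []).card = 1)
    (hnone : ∀ e ∈ T, ∀ (j : Fin k) (y : Fin m) (s : ℕ), (j :: e.1, (y, s)) ∈ T →
      ∃ j' : Fin k, ∀ lab : Fin m × ℕ, (j' :: j :: e.1, lab) ∉ T)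
    (hinj : ∀ e ∈ T, ∀ e' ∈ T, e.2.1 = e'.2.1 → e.1 = e'.1) :
    ((univ : Finset (Fin m → Fin k → Fin n × Bool)).filter fun Φ => ∀ e ∈ T, ∀ j : Fin k,
      (((Φ e.2.1 j).2 = true ↔ ((∃ (y : Fin m) (s : ℕ), (j :: e.1, (y, s)) ∈ T ∧ s % 2 = 0) ∨
        ((∀ lab : Fin m × ℕ, (j :: e.1, lab) ∉ T) ∧ e.2.2 % 2 = 1))) ∧
      ∀ (y : Fin m) (s : ℕ), (j :: e.1, (y, s)) ∈ T → ∃ j' : Fin k,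
        (∀ lab : Fin m × ℕ, (j' :: j :: e.1, lab) ∉ T) ∧
        (∀ j'' : Fin k, j'' < j' → ∃ lab : Fin m × ℕ, (j'' :: j :: e.1, lab) ∈ T) ∧
        (Φ e.2.1 j).1 = (Φ y j').1)).card
        * 2 ^ (T.card * k) * n ^ (T.card - 1)
      = Fintype.card (Fin m → Fin k → Fin n × Bool) := by
  -- elements with the same clause, or the same address, coincide
  have hinjE : ∀ e ∈ T, ∀ e' ∈ T, e.2.1 = e'.2.1 → e = e' := by
    intro e he e' he' h
    have h1 : e.1 = e'.1 := hinj e he e' he' h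
    have h2 : e.2 = e'.2 := hfun e.1 e.2 e'.2 (by simpa using he) (by rw [h1]; simpa using he')
    exact Prod.ext h1 h2
  have haddr : ∀ e ∈ T, ∀ e' ∈ T, e.1 = e'.1 → e = e' := by
    intro e he e' he' h1
    have h2 : e.2 = e'.2 := hfun e.1 e.2 e'.2 (by simpa using he) (by rw [h1]; simpa using he')
    exact Prod.ext h1 h2
  -- the sign constraints and the star system
  set Sg : Finset ((Fin m × Fin k) × Bool) := T.biUnion fun e => (univ : Finset (Fin k)).image
    fun j => ((e.2.1, j), decide ((∃ (y : Fin m) (s : ℕ), (j :: e.1, (y, s)) ∈ T ∧ s % 2 = 0) ∨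
      ((∀ lab : Fin m × ℕ, (j :: e.1, lab) ∉ T) ∧ e.2.2 % 2 = 1))) with hSg
  set F : Finset (((List (Fin k) × (Fin m × ℕ)) × (List (Fin k) × (Fin m × ℕ))) × (Fin k × Fin k)) :=
    ((T ×ˢ T) ×ˢ (univ : Finset (Fin k × Fin k))).filter fun q =>
      q.1.2.1 = q.2.1 :: q.1.1.1 ∧ (∀ lab : Fin m × ℕ, (q.2.2 :: q.1.2.1, lab) ∉ T) ∧
        ∀ j'' : Fin k, j'' < q.2.2 → ∃ lab : Fin m × ℕ, (j'' :: q.1.2.1, lab) ∈ T with hF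
  set E : Finset ((Fin m × Fin k) × (Fin m × Fin k)) :=
    F.image fun q => ((q.1.1.2.1, q.2.1), (q.1.2.2.1, q.2.2)) with hE
  have hmemF : ∀ q : ((List (Fin k) × (Fin m × ℕ)) × (List (Fin k) × (Fin m × ℕ))) × (Fin k × Fin k), q ∈ F ↔ q.1.1 ∈ T ∧ q.1.2 ∈ T ∧
      q.1.2.1 = q.2.1 :: q.1.1.1 ∧ (∀ lab : Fin m × ℕ, (q.2.2 :: q.1.2.1, lab) ∉ T) ∧
        ∀ j'' : Fin k, j'' < q.2.2 → ∃ lab : Fin m × ℕ, (j'' :: q.1.2.1, lab) ∈ T := by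
    intro q
    rw [hF, Finset.mem_filter, Finset.mem_product, Finset.mem_product]
    simp only [Finset.mem_univ, and_true]
    tauto
  have hmemSg : ∀ s : (Fin m × Fin k) × Bool, s ∈ Sg ↔ ∃ e ∈ T, ∃ j : Fin k,
      s = ((e.2.1, j), decide ((∃ (y : Fin m) (s : ℕ), (j :: e.1, (y, s)) ∈ T ∧ s % 2 = 0) ∨
        ((∀ lab : Fin m × ℕ, (j :: e.1, lab) ∉ T) ∧ e.2.2 % 2 = 1))) := by
    intro s
    rw [hSg, Finset.mem_biUnion]
    refine exists_congr fun e => and_congr_right fun _ => ?_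
    rw [Finset.mem_image]
    constructor
    · rintro ⟨j, _, hj⟩; exact ⟨j, hj.symm⟩
    · rintro ⟨j, hj⟩; exact ⟨j, mem_univ _, hj.symm⟩
  have hmemE : ∀ t : (Fin m × Fin k) × (Fin m × Fin k), t ∈ E ↔ ∃ e ∈ T, ∃ e' ∈ T, ∃ j j' : Fin k,
      e'.1 = j :: e.1 ∧ (∀ lab : Fin m × ℕ, (j' :: e'.1, lab) ∉ T) ∧
      (∀ j'' : Fin k, j'' < j' → ∃ lab : Fin m × ℕ, (j'' :: e'.1, lab) ∈ T) ∧
      t = ((e.2.1, j), (e'.2.1, j')) := by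
    intro t
    rw [hE, Finset.mem_image]
    constructor
    · rintro ⟨q, hq, hqt⟩
      rw [hmemF] at hq
      exact ⟨q.1.1, hq.1, q.1.2, hq.2.1, q.2.1, q.2.2, hq.2.2.1, hq.2.2.2.1, hq.2.2.2.2, hqt.symm⟩
    · rintro ⟨e, he, e', he', j, j', h1, h2, h3, rfl⟩
      exact ⟨((e, e'), (j, j')), (hmemF _).2 ⟨he, he', h1, h2, h3⟩, rfl⟩
  -- syntactic validity = sign constraints ∧ star equations
  have hSV : ∀ Φ : Fin m → Fin k → Fin n × Bool, (∀ e ∈ T, ∀ j : Fin k,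
      (((Φ e.2.1 j).2 = true ↔ ((∃ (y : Fin m) (s : ℕ), (j :: e.1, (y, s)) ∈ T ∧ s % 2 = 0) ∨
        ((∀ lab : Fin m × ℕ, (j :: e.1, lab) ∉ T) ∧ e.2.2 % 2 = 1))) ∧
      ∀ (y : Fin m) (s : ℕ), (j :: e.1, (y, s)) ∈ T → ∃ j' : Fin k,
        (∀ lab : Fin m × ℕ, (j' :: j :: e.1, lab) ∉ T) ∧
        (∀ j'' : Fin k, j'' < j' → ∃ lab : Fin m × ℕ, (j'' :: j :: e.1, lab) ∈ T) ∧
        (Φ e.2.1 j).1 = (Φ y j').1)) ↔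
      ((∀ s ∈ Sg, (Φ s.1.1 s.1.2).2 = s.2) ∧ ∀ t ∈ E, (Φ t.1.1 t.1.2).1 = (Φ t.2.1 t.2.2).1) := by
    intro Φ
    constructor
    · intro hsyn
      constructor
      · intro s hs
        obtain ⟨e, he, j, rfl⟩ := (hmemSg s).1 hs
        have hiff := (hsyn e he j).1
        simp only
        rw [Bool.eq_iff_iff, hiff, decide_eq_true_iff]
      · intro t ht
        obtain ⟨e, he, e', he', j, j', h1, h2, h3, rfl⟩ := (hmemE t).1 ht
        have hch : (j :: e.1, (e'.2.1, e'.2.2)) ∈ T := by rw [Prod.mk.eta, ← h1]; simpa using he'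
        obtain ⟨j₀, hno, hlt, heq⟩ := (hsyn e he j).2 e'.2.1 e'.2.2 hch
        have hjj : j₀ = j' := sissR_leastNone_unique T (j :: e.1) j₀ j' ⟨hno, hlt⟩
          ⟨by rw [← h1]; exact h2, by rw [← h1]; exact h3⟩
        rw [← hjj]
        exact heq
    · rintro ⟨hs, ht⟩ e he j
      constructor
      · have hmem : ((e.2.1, j), decide ((∃ (y : Fin m) (s : ℕ), (j :: e.1, (y, s)) ∈ T ∧ s % 2 = 0) ∨
            ((∀ lab : Fin m × ℕ, (j :: e.1, lab) ∉ T) ∧ e.2.2 % 2 = 1))) ∈ Sg :=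
          (hmemSg _).2 ⟨e, he, j, rfl⟩
        have h := hs _ hmem
        simp only at h
        rw [Bool.eq_iff_iff, decide_eq_true_iff] at h
        exact h
      · intro y s hys
        obtain ⟨j', hno, hlt⟩ := sissR_leastNone_exists T (j :: e.1) (hnone e he j y s hys)
        refine ⟨j', hno, hlt, ?_⟩
        have hmem : ((e.2.1, j), (y, j')) ∈ E :=
          (hmemE _).2 ⟨e, he, (j :: e.1, (y, s)), hys, j, j', rfl, hno, hlt, rfl⟩
        exact ht _ hmem
  -- the star conditions
  have hSg_fun : ∀ s ∈ Sg, ∀ s' ∈ Sg, s.1 = s'.1 → s = s' := by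
    intro s hs s' hs' h
    obtain ⟨e, he, j, rfl⟩ := (hmemSg s).1 hs
    obtain ⟨e₂, he₂, j₂, rfl⟩ := (hmemSg s').1 hs'
    simp only [Prod.mk.injEq] at h
    obtain ⟨hx, rfl⟩ := h
    obtain rfl : e = e₂ := hinjE e he e₂ he₂ hx
    rfl
  have hE_fun : ∀ t ∈ E, ∀ t' ∈ E, t.1 = t'.1 → t = t' := by
    intro t ht t' ht' h
    obtain ⟨e, he, e', he', j, j', h1, h2, h3, rfl⟩ := (hmemE t).1 ht
    obtain ⟨f, hf, f', hf', i, i', g1, g2, g3, rfl⟩ := (hmemE t').1 ht'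
    simp only [Prod.mk.injEq] at h
    obtain ⟨hx, rfl⟩ := h
    obtain rfl : e = f := hinjE e he f hf hx
    obtain rfl : e' = f' := haddr e' he' f' hf' (by rw [h1, g1])
    obtain rfl : j' = i' := sissR_leastNone_unique T e'.1 j' i' ⟨h2, h3⟩ ⟨g2, g3⟩
    rfl
  have hE_ctr : ∀ t ∈ E, ∀ t' ∈ E, t.1 ≠ t'.2 := by
    intro t ht t' ht' h
    obtain ⟨e, he, e', he', j, j', h1, _, _, rfl⟩ := (hmemE t).1 ht
    obtain ⟨f, hf, f', hf', i, i', _, g2, _, rfl⟩ := (hmemE t').1 ht'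
    simp only [Prod.mk.injEq] at h
    obtain ⟨hx, rfl⟩ := h
    obtain rfl : e = f' := hinjE e he f' hf' hx
    -- `e` has a child at `j :: e.1`, yet `j :: e.1` is childless
    exact g2 e'.2 (by rw [← h1]; simpa using he')
  -- the cardinalities
  have hcardSg : Sg.card = T.card * k := by
    rw [hSg, Finset.card_biUnion]
    · have : ∀ e ∈ T, ((univ : Finset (Fin k)).image fun j =>
          ((e.2.1, j), decide ((∃ (y : Fin m) (s : ℕ), (j :: e.1, (y, s)) ∈ T ∧ s % 2 = 0) ∨
            ((∀ lab : Fin m × ℕ, (j :: e.1, lab) ∉ T) ∧ e.2.2 % 2 = 1)))).card = k := by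
        intro e _
        rw [Finset.card_image_of_injective _ (fun j₁ j₂ h => by
          simp only [Prod.mk.injEq] at h; exact h.1.2), Finset.card_univ, Fintype.card_fin]
      rw [Finset.sum_congr rfl this, Finset.sum_const, smul_eq_mul]
    · intro e he e₂ he₂ hne
      rw [Function.onFun, Finset.disjoint_left]
      intro s hs hs₂
      rw [Finset.mem_image] at hs hs₂
      obtain ⟨j, _, rfl⟩ := hs
      obtain ⟨j₂, _, h⟩ := hs₂
      simp only [Prod.mk.injEq] at h
      exact hne (hinjE e he e₂ he₂ h.1.1.symm)
  have hcardF : F.card = (T.filter fun e => ¬ (e.1 = [])).card := by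
    refine Finset.card_bij (fun q _ => q.1.2) ?_ ?_ ?_
    · intro q hq
      rw [hmemF] at hq
      rw [Finset.mem_filter]
      refine ⟨hq.2.1, ?_⟩
      rw [hq.2.2.1]
      exact List.cons_ne_nil _ _
    · intro q₁ hq₁ q₂ hq₂ h
      rw [hmemF] at hq₁ hq₂
      have h12 : q₁.2.1 :: q₁.1.1.1 = q₂.2.1 :: q₂.1.1.1 := by rw [← hq₁.2.2.1, ← hq₂.2.2.1, h]
      rw [List.cons.injEq] at h12
      have hpar' : q₁.1.1 = q₂.1.1 := haddr _ hq₁.1 _ hq₂.1 h12.2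
      have hj' : q₁.2.2 = q₂.2.2 := sissR_leastNone_unique T q₁.1.2.1 _ _ hq₁.2.2.2
        (by rw [h]; exact hq₂.2.2.2)
      ext1
      · exact Prod.ext hpar' h
      · exact Prod.ext h12.1 hj'
    · intro e' he'
      rw [Finset.mem_filter] at he'
      obtain ⟨he'T, hne⟩ := he'
      obtain ⟨j, a, hja⟩ : ∃ (j : Fin k) (a : List (Fin k)), e'.1 = j :: a := by
        cases h : e'.1 with
        | nil => exact absurd h hne
        | cons j a => exact ⟨j, a, rfl⟩
      have he'' : (j :: a, (e'.2.1, e'.2.2)) ∈ T := by rw [Prod.mk.eta, ← hja]; simpa using he'T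
      obtain ⟨lab, hlab⟩ := hpar j a _ he''
      obtain ⟨j', hno, hlt⟩ := sissR_leastNone_exists T (j :: a)
        (hnone (a, lab) hlab j e'.2.1 e'.2.2 he'')
      refine ⟨(((a, lab), e'), (j, j')), (hmemF _).2 ⟨hlab, he'T, hja, ?_, ?_⟩, rfl⟩
      · rw [hja]; exact hno
      · rw [hja]; exact hlt
  have hcardE : E.card = T.card - 1 := by
    have hinjg : Set.InjOn (fun q : ((List (Fin k) × (Fin m × ℕ)) × (List (Fin k) × (Fin m × ℕ))) × (Fin k × Fin k) =>
        ((q.1.1.2.1, q.2.1), (q.1.2.2.1, q.2.2))) ↑F := by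
      intro q₁ hq₁ q₂ hq₂ h
      rw [Finset.mem_coe, hmemF] at hq₁ hq₂
      simp only [Prod.mk.injEq] at h
      obtain ⟨⟨hx, hj⟩, _, hj'⟩ := h
      have hpar' : q₁.1.1 = q₂.1.1 := hinjE _ hq₁.1 _ hq₂.1 hx
      have hch' : q₁.1.2 = q₂.1.2 := haddr _ hq₁.2.1 _ hq₂.2.1 (by rw [hq₁.2.2.1, hq₂.2.2.1, hj, hpar'])
      ext1
      · exact Prod.ext hpar' hch'
      · exact Prod.ext hj hj'
    rw [hE, Finset.card_image_of_injOn hinjg, hcardF]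
    have hsum := Finset.card_filter_add_card_filter_not (s := T) (fun e : (List (Fin k) × (Fin m × ℕ)) => e.1 = [])
    rw [hrootc] at hsum
    omega
  -- the star count
  have hstar := sissR_starCount (n := n) Sg hSg_fun E hE_fun hE_ctr
  rw [hcardSg, hcardE] at hstar
  rw [← hstar]
  congr 2
  exact congrArg Finset.card (Finset.filter_congr fun Φ _ => hSV Φ)

end TreeCount

end Summit.PneNP.PneNP.Theorems
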